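import Literature.AlgebraicGeometry.Resolution.AugmentationIdeal

/-!
# The Loewy flag of a ring endomorphism (higher augmentation ideals)

Topic: `Literature/AlgebraicGeometry/Resolution` (definition request `defn-AugmentationIdealLoewyFlag`,
route WildQuotient; idea card tame-ghost-of-a-wild-action-v2 §D1, (R), (K)). Builds on
`AugmentationIdeal.lean` (`augMap σ = σ - id`, `augIdeal σ`).

For a ring endomorphism `σ` of a commutative ring `B` the **Loewy flag** is the chain of ideals
generated by the images of the iterates of the augmentation map `σ - id`,
`loewyIdeal σ j := Ideal.span (Set.range (σ - id)^[j])`, i.e. `I⁽ʲ⁾ := ((σ - 1)^j B) · B`: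
`B = I⁽⁰⁾ ⊇ I⁽¹⁾ = augIdeal σ ⊇ I⁽²⁾ ⊇ ⋯`. The name is that of the idea card (the flag is read off
the Loewy series of `B` as a module over `𝔽_p[⟨σ⟩] ≅ 𝔽_p[T]/(T-1)^p` when `σ` has order `p` in
characteristic `p`); the objects are the standard higher augmentation ideals [folklore].

## Main statements (all PROVED; no named facts are introduced)

* `loewyIdeal_zero`, `loewyIdeal_one` (`augIdeal σ = loewyIdeal σ 1`), `loewyIdeal_antitone`,
  `apply_mem_loewyIdeal_of_mem` (each `I⁽ʲ⁾` is `σ`-stable).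
* `iterate_augMap_eq_zero` — in exponential characteristic `p`, `σ^[p] = id` implies
  `(σ - id)^[p] = 0` (`(σ - 1)^p = σ^p - 1` in the endomorphism ring); `loewyIdeal_eq_bot_of_le` —
  hence `I⁽ʲ⁾ = 0` for `j ≥ p`: the flag has length `≤ p` (card (R): "`(σ−1)^p = 0` in char `p`");
  `RingAut` versions `…_of_pow_eq_one` with the hypothesis `σ ^ p = 1`.
* `iterate_augMap_pred_apply` — in exponential characteristic `p`, `(σ - id)^[p-1] = ∑_{i<p} σ^[i]`
  (from `(T - 1)^{p-1} = ∑_{i<p} Tⁱ` in `𝔽_p[T]`), so `I⁽ᵖ⁻¹⁾` is generated by the traces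
  `∑_{i<p} σⁱ(b)` (card (K): "augmentation ideal down to the trace ideal").
* `map_loewyIdeal_of_isLocalization` — `I_σ⁽ʲ⁾ · S⁻¹B = I_τ⁽ʲ⁾` for an extension `τ` of `σ` to a
  localisation with `σ`-invariant denominators.

## Sources

* F. Király, W. Lütkebohmert, *Group actions of prime order on local normal rings*, Algebra &
  Number Theory 7 (2013) 63–74, doi:10.2140/ant.2013.7.63, §1 (the case `j = 1`).
  [KiralyLutkebohmert2013]

Not here: monomial-phase points, residue vectors and the Loewy clock of the idea card (they need
an snc family of `σ`-stable principal divisors on a regular local ring).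
-/

namespace Literature.AlgebraicGeometry.Resolution

open Function

variable {B : Type*} [CommRing B]
variable {F : Type*} [FunLike F B B]

/-! ## The Loewy ideals -/

section Loewy

variable [AddMonoidHomClass F B B]

/-- The `j`-th **Loewy ideal** of `σ`: the ideal generated by the image of the `j`-fold iterate
`(σ - id)^[j]` of the augmentation map, `I⁽ʲ⁾ := ((σ - 1)^j B) · B` (the `j`-th higher augmentation
ideal). The chain `B = I⁽⁰⁾ ⊇ I⁽¹⁾ = augIdeal σ ⊇ I⁽²⁾ ⊇ ⋯` is the **Loewy flag** of `σ` (idea card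
tame-ghost-of-a-wild-action-v2 §D1) [folklore]. -/
def loewyIdeal (σ : F) (j : ℕ) : Ideal B :=
  Ideal.span (Set.range (⇑(augMap σ))^[j])

/-- Unfolding lemma: `loewyIdeal σ j = Ideal.span (Set.range ((σ : B →+ B) - id)^[j])` [folklore]. -/
theorem loewyIdeal_def (σ : F) (j : ℕ) :
    loewyIdeal σ j = Ideal.span (Set.range (⇑((σ : B →+ B) - AddMonoidHom.id B))^[j]) := rfl

/-- `(σ - id)^[j] b ∈ I⁽ʲ⁾` [folklore]. -/
theorem iterate_augMap_mem_loewyIdeal (σ : F) (j : ℕ) (b : B) :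
    (⇑(augMap σ))^[j] b ∈ loewyIdeal σ j :=
  Ideal.subset_span ⟨b, rfl⟩

/-- `I⁽⁰⁾ = B` [folklore]. -/
@[simp]
theorem loewyIdeal_zero (σ : F) : loewyIdeal σ 0 = ⊤ := by
  rw [loewyIdeal, iterate_zero, Set.range_id, Ideal.span_univ]

/-- `I⁽¹⁾` is the augmentation ideal [folklore]. -/
@[simp]
theorem loewyIdeal_one (σ : F) : loewyIdeal σ 1 = augIdeal σ := by
  rw [loewyIdeal, iterate_one]
  rfl

/-- `augIdeal σ = loewyIdeal σ 1` [folklore]. -/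
theorem augIdeal_eq_loewyIdeal_one (σ : F) : augIdeal σ = loewyIdeal σ 1 :=
  (loewyIdeal_one σ).symm

/-- The flag is decreasing: `I⁽ʲ⁺¹⁾ ≤ I⁽ʲ⁾` [folklore]. -/
theorem loewyIdeal_succ_le (σ : F) (j : ℕ) : loewyIdeal σ (j + 1) ≤ loewyIdeal σ j := by
  refine Ideal.span_le.2 ?_
  rintro _ ⟨b, rfl⟩
  rw [iterate_succ_apply]
  exact Ideal.subset_span ⟨_, rfl⟩

/-- The flag is decreasing [folklore]. -/
theorem loewyIdeal_antitone (σ : F) : Antitone (loewyIdeal σ) :=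
  antitone_nat_of_succ_le (loewyIdeal_succ_le σ)

/-- Every `I⁽ʲ⁾`, `j ≥ 1`, is contained in the augmentation ideal [folklore]. -/
theorem loewyIdeal_le_augIdeal (σ : F) {j : ℕ} (hj : 1 ≤ j) : loewyIdeal σ j ≤ augIdeal σ :=
  (loewyIdeal_antitone σ hj).trans_eq (loewyIdeal_one σ)

/-! ## Nilpotency in characteristic `p` -/

/-- **Nilpotency of the augmentation map.** If `B` has exponential characteristic `p` and
`σ^[p] = id`, then `(σ - id)^[p] = 0`: in the endomorphism ring `Module.End ℤ B` (of exponential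
characteristic `p`), `(σ - 1)^p = σ^p - 1 = 0` (idea card tame-ghost-of-a-wild-action-v2 (R):
"`(σ−1)^p = 0` in char `p`") [folklore]. -/
theorem iterate_augMap_eq_zero (p : ℕ) [ExpChar B p] {σ : F} (hσ : (⇑σ)^[p] = id) :
    (⇑(augMap σ))^[p] = 0 := by
  haveI : ExpChar (Module.End ℤ B) p :=
    expChar_of_injective_ringHom (f := (Algebra.lmul ℤ B).toRingHom) (Algebra.lmul_injective) p
  set s : Module.End ℤ B := (σ : B →+ B).toIntLinearMap with hs
  have hcoe : (⇑s : B → B) = ⇑σ := rfl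
  have hsp : s ^ p = 1 := by
    apply LinearMap.ext
    intro b
    rw [Module.End.pow_apply, hcoe, hσ, Module.End.one_apply, id]
  have hd : (⇑(augMap σ) : B → B) = ⇑(s - 1) := rfl
  have hnil : (s - 1) ^ p = 0 := by
    rw [sub_pow_expChar_of_commute p (Commute.one_right s), hsp, one_pow, sub_self]
  rw [hd, ← Module.End.coe_pow, hnil]
  rfl

/-- Hence the Loewy flag has length at most `p`: `I⁽ʲ⁾ = 0` for `j ≥ p` [folklore]. -/
theorem loewyIdeal_eq_bot_of_le (p : ℕ) [ExpChar B p] {σ : F} (hσ : (⇑σ)^[p] = id) {j : ℕ}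
    (hj : p ≤ j) : loewyIdeal σ j = ⊥ := by
  refine le_bot_iff.1 ((loewyIdeal_antitone σ hj).trans ?_)
  rw [loewyIdeal, iterate_augMap_eq_zero p hσ]
  refine Ideal.span_le.2 ?_
  rintro _ ⟨b, rfl⟩
  simp

/-! ## The last Loewy step is the trace -/

/-- **The last Loewy step is the trace.** In exponential characteristic `p`,
`(σ - id)^[p-1] = ∑_{i<p} σ^[i]` as maps `B → B` (no hypothesis on the order of `σ`): in `𝔽_p[T]`
one has `(T - 1) · ∑_{i<p} Tⁱ = Tᵖ - 1 = (T - 1)ᵖ`, whence `(T - 1)^{p-1} = ∑_{i<p} Tⁱ`, evaluated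
at `σ` in the `𝔽_p`-algebra `Module.End ℤ B`. For `σ` of order `p` the right-hand side is the
trace `∑_{g ∈ ⟨σ⟩} g(b)` (idea card tame-ghost-of-a-wild-action-v2 (K): "augmentation ideal down to
the trace ideal") [folklore]. -/
theorem iterate_augMap_pred_apply (p : ℕ) [hE : ExpChar B p] (σ : F) (b : B) :
    (⇑(augMap σ))^[p - 1] b = ∑ i ∈ Finset.range p, (⇑σ)^[i] b := by
  cases hE with
  | zero => simp
  | prime hprime =>
    haveI := Fact.mk hprime
    -- the polynomial identity `(X - 1)^(p-1) = ∑_{i<p} X^i` over `𝔽_p`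
    have hpoly : ((Polynomial.X : Polynomial (ZMod p)) - 1) ^ (p - 1) =
        ∑ i ∈ Finset.range p, Polynomial.X ^ i := by
      have hX : (Polynomial.X : Polynomial (ZMod p)) - 1 ≠ 0 := by
        rw [← map_one Polynomial.C]
        exact Polynomial.X_sub_C_ne_zero 1
      apply mul_left_cancel₀ hX
      calc (Polynomial.X - 1) * (Polynomial.X - 1) ^ (p - 1)
          = ((Polynomial.X : Polynomial (ZMod p)) - 1) ^ p := by
            rw [← pow_succ', Nat.sub_add_cancel hprime.one_le]
        _ = Polynomial.X ^ p - 1 := by rw [sub_pow_char, one_pow]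
        _ = (Polynomial.X - 1) * ∑ i ∈ Finset.range p, Polynomial.X ^ i := (mul_geom_sum _ _).symm
    -- evaluate it at `σ` in the endomorphism ring `Module.End ℤ B`, an `𝔽_p`-algebra
    haveI : CharP (Module.End ℤ B) p :=
      charP_of_injective_ringHom (f := (Algebra.lmul ℤ B).toRingHom) (Algebra.lmul_injective) p
    letI : Algebra (ZMod p) (Module.End ℤ B) := ZMod.algebra _ p
    set s : Module.End ℤ B := (σ : B →+ B).toIntLinearMap with hs
    have hcoe : (⇑s : B → B) = ⇑σ := rfl
    have hev := congrArg (Polynomial.aeval (R := ZMod p) s) hpoly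
    simp only [map_pow, map_sub, map_sum, Polynomial.aeval_X, map_one] at hev
    have hd : (⇑(augMap σ) : B → B) = ⇑(s - 1) := rfl
    rw [hd, ← Module.End.coe_pow, hev]
    simp only [LinearMap.coe_sum, Finset.sum_apply, Module.End.coe_pow, hcoe]

/-- Hence `I⁽ᵖ⁻¹⁾` is the ideal generated by the "traces" `∑_{i<p} σ^[i] b` [folklore]. -/
theorem loewyIdeal_pred_eq_span_range_trace (p : ℕ) [ExpChar B p] (σ : F) :
    loewyIdeal σ (p - 1) =
      Ideal.span (Set.range fun b : B => ∑ i ∈ Finset.range p, (⇑σ)^[i] b) := by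
  rw [loewyIdeal]
  congr 2
  exact funext (iterate_augMap_pred_apply p σ)

end Loewy

/-! ## `σ`-stability -/

section LoewyStable

variable [RingHomClass F B B]

/-- The augmentation map preserves each Loewy ideal: `(σ - id)(I⁽ʲ⁾) ⊆ I⁽ʲ⁾` (for the module step
use `I(a y) = I(y) σ(a) + y I(a)`) [folklore]. -/
theorem augMap_mem_loewyIdeal_of_mem (σ : F) {j : ℕ} {x : B} (hx : x ∈ loewyIdeal σ j) :
    augMap σ x ∈ loewyIdeal σ j := by
  induction hx using Submodule.span_induction with
  | mem y hy =>
    obtain ⟨b, rfl⟩ := hy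
    refine loewyIdeal_succ_le σ j ?_
    rw [← iterate_succ_apply' (f := ⇑(augMap σ))]
    exact iterate_augMap_mem_loewyIdeal σ (j + 1) b
  | zero => simp
  | add y z _ _ ihy ihz =>
    rw [map_add]
    exact add_mem ihy ihz
  | smul a y hy ih =>
    rw [smul_eq_mul, mul_comm, augMap_mul]
    exact add_mem (Ideal.mul_mem_right _ _ ih) (Ideal.mul_mem_right _ _ hy)

/-- Each Loewy ideal is `σ`-stable [folklore]. -/
theorem apply_mem_loewyIdeal_of_mem (σ : F) {j : ℕ} {x : B} (hx : x ∈ loewyIdeal σ j) :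
    σ x ∈ loewyIdeal σ j := by
  rw [apply_eq_add_augMap σ x]
  exact add_mem hx (augMap_mem_loewyIdeal_of_mem σ hx)

end LoewyStable

/-! ## Ring automorphisms of finite order `p` in characteristic `p` -/

section RingAut

/-- For a ring automorphism `σ` with `σ ^ p = 1` on a ring of exponential characteristic `p`,
`(σ - id)^[p] = 0` [folklore]. -/
theorem iterate_augMap_eq_zero_of_pow_eq_one (p : ℕ) [ExpChar B p] {σ : B ≃+* B}
    (hσ : σ ^ p = 1) : (⇑(augMap σ))^[p] = 0 :=
  iterate_augMap_eq_zero p (by rw [← RingAut.coe_pow, hσ, RingAut.coe_one])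

/-- For a ring automorphism `σ` with `σ ^ p = 1` on a ring of exponential characteristic `p`, the
Loewy flag stops: `loewyIdeal σ j = ⊥` for `p ≤ j` [folklore]. -/
theorem loewyIdeal_eq_bot_of_pow_eq_one (p : ℕ) [ExpChar B p] {σ : B ≃+* B} (hσ : σ ^ p = 1)
    {j : ℕ} (hj : p ≤ j) : loewyIdeal σ j = ⊥ :=
  loewyIdeal_eq_bot_of_le p (by rw [← RingAut.coe_pow, hσ, RingAut.coe_one]) hj

/-- For a ring automorphism `σ` with `σ ^ p = 1` on a ring of exponential characteristic `p`, the
last Loewy map is the trace of `⟨σ⟩`: `(σ - id)^[p-1] b = ∑_{i<p} σ^i b` [folklore]. -/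
theorem iterate_augMap_pred_apply_eq_sum_pow (p : ℕ) [ExpChar B p] (σ : B ≃+* B) (b : B) :
    (⇑(augMap σ))^[p - 1] b = ∑ i ∈ Finset.range p, (σ ^ i) b := by
  simp only [RingAut.coe_pow]
  exact iterate_augMap_pred_apply p σ b

end RingAut

/-! ## Behaviour under localisation -/

section Localization

variable {L : Type*} [CommRing L] [Algebra B L]
variable {G : Type*} [FunLike G L L] [RingHomClass G L L] [RingHomClass F B B]

/-- **The Loewy flag localises for invariant denominators.** Let `L = S⁻¹B`, `τ` a ring
endomorphism of `L` extending `σ`, and assume `σ` fixes `S` pointwise. Then `I_σ⁽ʲ⁾ · L = I_τ⁽ʲ⁾`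
for every `j` (by `(τ - id)^j (b/s) = ((σ - id)^j b)/s`) [folklore]. -/
theorem map_loewyIdeal_of_isLocalization (S : Submonoid B) [IsLocalization S L] (σ : F) (τ : G)
    (h : ∀ b, τ (algebraMap B L b) = algebraMap B L (σ b)) (hS : ∀ s ∈ S, σ s = s) (j : ℕ) :
    (loewyIdeal σ j).map (algebraMap B L) = loewyIdeal τ j := by
  apply le_antisymm
  · rw [loewyIdeal, Ideal.map_span]
    refine Ideal.span_le.2 ?_
    rintro _ ⟨_, ⟨b, rfl⟩, rfl⟩
    rw [semiconj_iterate_augMap h]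
    exact iterate_augMap_mem_loewyIdeal τ j _
  · refine Ideal.span_le.2 ?_
    rintro _ ⟨x, rfl⟩
    obtain ⟨b, s, rfl⟩ := IsLocalization.exists_mk'_eq S x
    rw [SetLike.mem_coe, iterate_augMap_mk'_of_isLocalization S h hS,
      IsLocalization.mk'_eq_mul_mk'_one]
    exact Ideal.mul_mem_right _ _ (Ideal.mem_map_of_mem _ (iterate_augMap_mem_loewyIdeal σ j b))

/-- In particular (case `j = 1`, no invariance needed: see `map_augIdeal_of_isLocalization`) and for
all `j` with invariant denominators, the Loewy flag of the localisation is the extension of the Loewy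
flag [folklore]. -/
theorem loewyIdeal_one_map_of_isLocalization (S : Submonoid B) [IsLocalization S L] (σ : F)
    (τ : G) (h : ∀ b, τ (algebraMap B L b) = algebraMap B L (σ b)) :
    (loewyIdeal σ 1).map (algebraMap B L) = loewyIdeal τ 1 := by
  rw [loewyIdeal_one, loewyIdeal_one, map_augIdeal_of_isLocalization S σ τ h]

end Localization

end Literature.AlgebraicGeometry.Resolution
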